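import Literature.Analysis.PDE.EllipticSmoothBootstrapTD
import Literature.Analysis.Calculus.MultilinearComponentBounds
import HarnessLib

/-!
# The Gilbarg–Trudinger 17.16 bootstrap, II: the linear equations for the derivatives

Second layer of the a-priori bootstrap of Gilbarg–Trudinger (2001), Lemma 17.16 (see
`Literature/Analysis/PDE/EllipticSmoothBootstrap.lean`).  For a solution `u` of
`G(y, θ, cjet₂ u(y)) = 0` the `(n+1)`-st differentiated equation
`iterTD (n+1) M' G (y, θ, cjet_{n+3} u(y)) = 0`
(`Literature/Analysis/PDE/EllipticSmoothBootstrapTD.lean`)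
is, for the unknown `v(y) = D^{n+1}u(y)(e_{M' 0}, …, e_{M' n})`, a LINEAR second-order equation
`∑_{ab} ã^{ab}(y) D²v(y)(e_a, e_b) = f(y)` whose coefficients
`ã^{ab}(y) = symCoef G a b (y, θ, cjet₂ u(y))` are the (symmetrised) top-order symbol of the
ORIGINAL equation — the same for all `n` and `M'` — and whose right-hand side
`f(y) = rhsFun n M i G (y, θ, cjet_{n+2} u(y))` is a smooth function of the `(n+2)`-jet only
(`sum_symCoef_mul_iteratedFDeriv_two_eq_rhsFun`).  This file provides exactly the inputs of the
interior Schauder estimate `Literature.Analysis.PDE.exists_schauder_interior_ball` for this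
equation, with constants uniform over families `(θ_k, u_k)`:

* `topSym`, `symCoef`, `rhsFun` and their smoothness (`contDiffOn_symCoef`,
  `contDiffOn_rhsFun`);
* ellipticity of `ã` from the ellipticity of `∂_{J₂}G` on rank-one jets (`symCoef_lower`) and the
  upper bound of a quadratic form with bounded coefficients (`sum_sum_mul_mul_le`);
* `iteratedFDeriv_basis_eq_two`: the components of `D^{n+3}u` in the basis are second
  derivatives of the unknowns `v`, so componentwise Schauder bounds for the `v`'s bound
  `D^{n+3}u` (`Literature/Analysis/Calculus/MultilinearComponentBounds.lean`).

The uniform Hölder data of coefficients, right-hand sides and unknowns along a bounded family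
are in `Literature/Analysis/PDE/EllipticSmoothBootstrapData.lean`.  Everything is fully proved;
no named facts.

## References

* D. Gilbarg, N. S. Trudinger, *Elliptic Partial Differential Equations of Second Order*,
  Classics in Mathematics, Springer 2001, Lemma 17.16 and §6.1. [GilbargTrudinger2001]
-/

noncomputable section

open scoped ContDiff Topology NNReal InnerProductSpace
open Set Function Metric
open Literature.Analysis.Calculus

namespace Literature.Analysis.PDE

variable {ι : Type*} [Fintype ι] [DecidableEq ι] {E : Type*} [NormedAddCommGroup E]
  [InnerProductSpace ℝ E]
variable {P : Type*} [NormedAddCommGroup P] [NormedSpace ℝ P]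

/-! ### The top-order symbol and the coefficients of the differentiated equations -/

section Symbol

/-- **Top-order symbol** of `G` at `w = (y, θ, J)`: the linear functional
`W ↦ DG(w) · (0, 0, single₂ W)` on top-slot directions `W : (Fin 2 → ι) → ℝ`. [folklore] -/
def topSym (G : E × P × CJet ι 2 → ℝ) (w : E × P × CJet ι 2) : ((Fin 2 → ι) → ℝ) →L[ℝ] ℝ :=
  (fderiv ℝ G w).comp ((ContinuousLinearMap.inr ℝ E (P × CJet ι 2)).comp
    ((ContinuousLinearMap.inr ℝ P (CJet ι 2)).comp
      (ContinuousLinearMap.single ℝ (fun j : Fin 3 => (Fin (j : ℕ) → ι) → ℝ) (Fin.last 2))))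

omit [Fintype ι] [DecidableEq ι] in
/-- `topSym G w W = DG(w) · (0, 0, single₂ W)`. [folklore] -/
@[simp] theorem topSym_apply (G : E × P × CJet ι 2 → ℝ) (w : E × P × CJet ι 2)
    (W : (Fin 2 → ι) → ℝ) :
    topSym G w W = fderiv ℝ G w ((0 : E), (0 : P), Pi.single (Fin.last 2) W) := rfl

/-- **Expansion of the symbol in the elementary directions** `δ_{ab} = single ![a, b] 1`:
`topSym W = ∑_{ab} topSym(δ_{ab}) W(a, b)`. [folklore] -/
theorem topSym_eq_sum (G : E × P × CJet ι 2 → ℝ) (w : E × P × CJet ι 2)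
    (W : (Fin 2 → ι) → ℝ) :
    topSym G w W = ∑ a, ∑ b, topSym G w (Pi.single ![a, b] 1) * W ![a, b] := by
  have h1 : topSym G w W = ∑ c : Fin 2 → ι, topSym G w (Pi.single c 1) * W c := by
    conv_lhs => rw [← Finset.univ_sum_single W, map_sum]
    refine Finset.sum_congr rfl fun c _ => ?_
    rw [show Pi.single c (W c) = W c • (Pi.single c (1 : ℝ) : (Fin 2 → ι) → ℝ) by
      rw [← Pi.single_smul', smul_eq_mul, mul_one], map_smul, smul_eq_mul, mul_comm]
  rw [h1, ← Fintype.sum_prod_type' (fun a b => topSym G w (Pi.single ![a, b] 1) * W ![a, b])]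
  exact (Fintype.sum_equiv (finTwoArrowEquiv ι).symm _ _ fun p => rfl).symm

/-- **The symmetrised coefficients** of `D²v(e_a, e_b)` in every differentiated equation:
`ã^{ab}(w) = (∂_{J₂}G(w)[δ_{ab}] + ∂_{J₂}G(w)[δ_{ba}]) / 2`. [folklore] -/
def symCoef (G : E × P × CJet ι 2 → ℝ) (a b : ι) (w : E × P × CJet ι 2) : ℝ :=
  (topSym G w (Pi.single ![a, b] 1) + topSym G w (Pi.single ![b, a] 1)) / 2

omit [Fintype ι] in
/-- The coefficients are symmetric. [folklore] -/
theorem symCoef_comm (G : E × P × CJet ι 2 → ℝ) (a b : ι) (w : E × P × CJet ι 2) :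
    symCoef G a b w = symCoef G b a w := by
  rw [symCoef, symCoef, add_comm]

omit [DecidableEq ι] in
/-- Symmetrising the coefficients of a symmetric quadratic expression changes nothing.
[folklore] -/
theorem sum_sum_symm_mul {A q : ι → ι → ℝ} (hq : ∀ a b, q a b = q b a) :
    ∑ a, ∑ b, (A a b + A b a) / 2 * q a b = ∑ a, ∑ b, A a b * q a b := by
  have h : ∑ a, ∑ b, A b a * q a b = ∑ a, ∑ b, A a b * q a b := by
    rw [Finset.sum_comm]
    exact Finset.sum_congr rfl fun a _ => Finset.sum_congr rfl fun b _ => by rw [hq]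
  have h2 : ∀ a b, (A a b + A b a) / 2 * q a b = (A a b * q a b) / 2 + (A b a * q a b) / 2 :=
    fun a b => by ring
  simp_rw [h2, Finset.sum_add_distrib, ← Finset.sum_div, h]
  ring

/-- **The symmetrised coefficients reproduce the symbol on symmetric data**:
`∑_{ab} ã^{ab} q_{ab} = topSym (I ↦ q_{I 0, I 1})` for symmetric `q`. [folklore] -/
theorem sum_symCoef_mul (G : E × P × CJet ι 2 → ℝ) (w : E × P × CJet ι 2) {q : ι → ι → ℝ}
    (hq : ∀ a b, q a b = q b a) :
    ∑ a, ∑ b, symCoef G a b w * q a b = topSym G w (fun I => q (I 0) (I 1)) := by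
  simp only [symCoef]
  rw [sum_sum_symm_mul hq, topSym_eq_sum]
  simp

/-- **Lower ellipticity of the coefficients** from the ellipticity of `∂_{J₂}G` on rank-one
top-slot jets `I ↦ η(e_{I 0}) η(e_{I 1})`: `λ ∑ ξ_a² ≤ ∑ ã^{ab} ξ_a ξ_b`. [folklore] -/
theorem symCoef_lower (bE : OrthonormalBasis ι ℝ E) (G : E × P × CJet ι 2 → ℝ)
    (w : E × P × CJet ι 2) {l : ℝ}
    (hw : ∀ η : E →L[ℝ] ℝ, l * ‖η‖ ^ 2 ≤ topSym G w (fun I => η (bE (I 0)) * η (bE (I 1))))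
    (ξ : ι → ℝ) : l * ∑ a, ξ a ^ 2 ≤ ∑ a, ∑ b, symCoef G a b w * ξ a * ξ b := by
  set x : E := ∑ a, ξ a • bE a with hx
  have hη : ∀ c, innerSL ℝ x (bE c) = ξ c := fun c => by
    rw [innerSL_apply_apply, hx, bE.orthonormal.inner_left_fintype]
    simp
  have hnorm : ‖innerSL ℝ x‖ ^ 2 = ∑ a, ξ a ^ 2 := by
    rw [innerSL_apply_norm, ← real_inner_self_eq_norm_sq, hx, bE.orthonormal.inner_sum]
    simp [sq]
  have h := hw (innerSL ℝ x)
  simp only [hη, hnorm] at h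
  simp_rw [mul_assoc]
  rwa [sum_symCoef_mul G w (q := fun a b => ξ a * ξ b) (fun a b => mul_comm _ _)]

omit [DecidableEq ι] in
/-- `f a b ≤ ∑∑ f` for nonnegative reals. [folklore] -/
theorem le_sum_sum {f : ι → ι → ℝ≥0} (a b : ι) : f a b ≤ ∑ a', ∑ b', f a' b' :=
  (Finset.single_le_sum (f := fun b' => f a b') (fun _ _ => zero_le) (Finset.mem_univ b)).trans
    (Finset.single_le_sum (f := fun a' => ∑ b', f a' b') (fun _ _ => zero_le)
      (Finset.mem_univ a))

omit [DecidableEq ι] in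
/-- **Upper bound of a quadratic form with bounded coefficients**:
`∑ a^{ab} ξ_a ξ_b ≤ card(ι) K ∑ ξ_a²` if `|a^{ab}| ≤ K`. [folklore] -/
theorem sum_sum_mul_mul_le {A : ι → ι → ℝ} {K : ℝ} (hA : ∀ a b, ‖A a b‖ ≤ K) (ξ : ι → ℝ) :
    ∑ a, ∑ b, A a b * ξ a * ξ b ≤ Fintype.card ι * K * ∑ a, ξ a ^ 2 := by
  rcases isEmpty_or_nonempty ι with hι | hι
  · simp
  have hK : 0 ≤ K := (norm_nonneg _).trans (hA (Classical.arbitrary _) (Classical.arbitrary _))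
  calc ∑ a, ∑ b, A a b * ξ a * ξ b ≤ ∑ a, ∑ b, K * ((ξ a ^ 2 + ξ b ^ 2) / 2) := by
        refine Finset.sum_le_sum fun a _ => Finset.sum_le_sum fun b _ => ?_
        calc A a b * ξ a * ξ b ≤ |A a b * ξ a * ξ b| := le_abs_self _
          _ = ‖A a b‖ * (|ξ a| * |ξ b|) := by rw [abs_mul, abs_mul, Real.norm_eq_abs, mul_assoc]
          _ ≤ K * ((ξ a ^ 2 + ξ b ^ 2) / 2) := by
              refine mul_le_mul (hA a b) ?_ (by positivity) hK
              nlinarith [two_mul_le_add_sq (|ξ a|) (|ξ b|), sq_abs (ξ a), sq_abs (ξ b)]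
    _ = Fintype.card ι * K * ∑ a, ξ a ^ 2 := by
        simp only [mul_add, add_div, Finset.sum_add_distrib, Finset.sum_const, Finset.card_univ,
          nsmul_eq_mul, ← Finset.mul_sum, ← Finset.sum_div]
        ring

end Symbol


/-! ### The right-hand sides and the linear equations for the unknowns -/

section Equation

/-- **The right-hand side functional** of the differentiated equation for the unknown
`v = D^{n+1}u(·)(e_M, e_i)`:
`rhsFun n M i G (y, θ, J) = -D(iterTD n M G)(y, θ, J)·(e_i, 0, ins_i (J, 0))`,
the part of `TD e_i (iterTD n M G)` not involving the top jet slot; a smooth function of the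
`(n+2)`-jet `J`. [folklore] -/
def rhsFun (bE : OrthonormalBasis ι ℝ E) (n : ℕ) (M : Fin n → ι) (i : ι)
    (G : E × P × CJet ι 2 → ℝ) (w : E × P × CJet ι (n + 2)) : ℝ :=
  -fderiv ℝ (iterTD bE n M G) w (bE i, (0 : P), CJet.ins ι (n + 2) i (jetPad ι (n + 2) w.2.2))

omit [DecidableEq ι] in
/-- `rhsFun n M i G` is `C^∞` on `{y ∈ O}` if `G` is. [folklore] -/
theorem contDiffOn_rhsFun (bE : OrthonormalBasis ι ℝ E) {G : E × P × CJet ι 2 → ℝ} {O : Set E}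
    (hO : IsOpen O) (hG : ContDiffOn ℝ ∞ G {x | x.1 ∈ O}) (n : ℕ) (M : Fin n → ι) (i : ι) :
    ContDiffOn ℝ ∞ (rhsFun bE n M i G) {w | w.1 ∈ O} := by
  have hopen : IsOpen {w : E × P × CJet ι (n + 2) | w.1 ∈ O} := hO.preimage continuous_fst
  have h1 : ContDiffOn ℝ ∞ (fderiv ℝ (iterTD bE n M G)) {w | w.1 ∈ O} :=
    (contDiffOn_iterTD bE hO hG n M).fderiv_of_isOpen hopen (le_of_eq rfl)
  have h2 : ContDiff ℝ ∞ (fun w : E × P × CJet ι (n + 2) =>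
      ((bE i : E), (0 : P), CJet.ins ι (n + 2) i (jetPad ι (n + 2) w.2.2))) :=
    contDiff_const.prodMk (contDiff_const.prodMk
      (((CJet.ins ι (n + 2) i).comp (jetPad ι (n + 2))).contDiff.comp
        (contDiff_snd.comp contDiff_snd)))
  exact (h1.clm_apply h2.contDiffOn).neg

/-- The coefficients `symCoef G a b` are `C^∞` on `{y ∈ O}` if `G` is. [folklore] -/
theorem contDiffOn_symCoef {G : E × P × CJet ι 2 → ℝ} {O : Set E} (hO : IsOpen O)
    (hG : ContDiffOn ℝ ∞ G {x | x.1 ∈ O}) (a b : ι) :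
    ContDiffOn ℝ ∞ (symCoef G a b) {w | w.1 ∈ O} := by
  have hopen : IsOpen {w : E × P × CJet ι 2 | w.1 ∈ O} := hO.preimage continuous_fst
  have h1 : ContDiffOn ℝ ∞ (fderiv ℝ G) {w | w.1 ∈ O} := hG.fderiv_of_isOpen hopen (le_of_eq rfl)
  have h : ∀ c : Fin 2 → ι, ContDiffOn ℝ ∞ (fun w => topSym G w (Pi.single c 1)) {w | w.1 ∈ O} :=
    fun c => by
      simp only [topSym_apply]
      exact h1.clm_apply contDiffOn_const
  exact ((h _).add (h _)).div_const _

/-- **The linear equation for the unknown.** If `u ∈ C^∞(O)` solves `G(y, θ, cjet₂ u(y)) = 0` on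
a ball `B ⊆ O`, then on `B` the unknown `v = D^{n+1}u(·)(e_{M 0}, …, e_{M (n-1)}, e_i)` solves
`∑_{ab} ã^{ab}(z) D²v(z)(e_a, e_b) = rhsFun n M i G (z, θ, cjet_{n+2} u(z))` with
`ã^{ab}(z) = symCoef G a b (z, θ, cjet₂ u(z))`: the differentiated equation
`TD e_i (iterTD n M G) = 0` along the `(n+3)`-jets splits (`TD_eq_symbol_add`) into its top-order
part — by the inherited symbol (`fderiv_iterTD_single_last`) the symbol of `G` applied to the
components `D^{n+3}u(e_a, e_b, e_M, e_i) = D²v(e_a, e_b)` — and the remainder `-rhsFun`.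
[cite: GilbargTrudinger2001, Lemma 17.16] -/
theorem sum_symCoef_mul_iteratedFDeriv_two_eq_rhsFun (bE : OrthonormalBasis ι ℝ E)
    {G : E × P × CJet ι 2 → ℝ} {O : Set E} (hO : IsOpen O)
    (hG : ContDiffOn ℝ ∞ G {x | x.1 ∈ O}) {x₀ : E} {R : ℝ} (hRO : ball x₀ R ⊆ O) {θ : P}
    {u : E → ℝ} (hu : ContDiffOn ℝ ∞ u O) (h0 : ∀ y ∈ ball x₀ R, G (y, θ, cjetOf bE 2 u y) = 0)
    (n : ℕ) (M : Fin n → ι) (i : ι) {z : E} (hz : z ∈ ball x₀ R) :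
    ∑ a, ∑ b, symCoef G a b (z, θ, cjetOf bE 2 u z) *
        iteratedFDeriv ℝ 2
          (fun x => iteratedFDeriv ℝ (n + 1) u x (fun t => bE (Fin.snoc (α := fun _ => ι) M i t)))
          z ![bE a, bE b] =
      rhsFun bE n M i G (z, θ, cjetOf bE (n + 2) u z) := by
  have hzO : z ∈ O := hRO hz
  have huz : ContDiffAt ℝ ∞ u z := hu.contDiffAt (hO.mem_nhds hzO)
  -- the differentiated equation of level `n + 1`, split into symbol and remainder
  have hvan : iterTD bE (n + 1) (Fin.snoc M i) G (z, θ, cjetOf bE (n + 2 + 1) u z) = 0 :=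
    iterTD_comp_cjetOf_eq_zero bE hO hG hRO hu h0 (n + 1) (Fin.snoc M i) z hz
  rw [iterTD_succ_snoc, TD_eq_symbol_add bE (iterTD bE n M G) i z θ, ins_sub_single_last_eq,
    CJet.trunc_cjetOf, fderiv_iterTD_single_last bE hO hG n M hzO θ _ _, truncTo2_cjetOf] at hvan
  -- the components of `D^{n+3}u` entering the symbol are second derivatives of `v`
  have hW : ∀ I₂ : Fin 2 → ι,
      iteratedFDeriv ℝ (n + 2 + 1) u z
          (fun t => bE (Fin.snoc (α := fun _ => ι) (Fin.cons (I₂ 0) (Fin.cons (I₂ 1) M)) i t)) =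
        iteratedFDeriv ℝ 2
          (fun x => iteratedFDeriv ℝ (n + 1) u x (fun t => bE (Fin.snoc (α := fun _ => ι) M i t)))
          z ![bE (I₂ 0), bE (I₂ 1)] := by
    intro I₂
    rw [iteratedFDeriv_two_iteratedFDeriv_apply_const (huz.of_le (WithTop.coe_le_coe.2 le_top)),
      ← Fin.cons_snoc_eq_snoc_cons, ← Fin.cons_snoc_eq_snoc_cons]
    exact congrArg (iteratedFDeriv ℝ (n + 2 + 1) u z)
      (funext fun t => Fin.cases rfl (fun s => Fin.cases rfl (fun r => rfl) s) t)
  have key : fderiv ℝ G (z, θ, cjetOf bE 2 u z) ((0 : E), (0 : P), Pi.single (Fin.last 2)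
      (fun I : Fin 2 → ι => iteratedFDeriv ℝ 2
        (fun x => iteratedFDeriv ℝ (n + 1) u x (fun t => bE (Fin.snoc (α := fun _ => ι) M i t))) z
          ![bE (I 0), bE (I 1)])) +
      fderiv ℝ (iterTD bE n M G) (z, θ, cjetOf bE (n + 2) u z)
        (bE i, (0 : P), CJet.ins ι (n + 2) i (jetPad ι (n + 2) (cjetOf bE (n + 2) u z))) = 0 := by
    rw [show (fun I : Fin 2 → ι => iteratedFDeriv ℝ 2
        (fun x => iteratedFDeriv ℝ (n + 1) u x (fun t => bE (Fin.snoc (α := fun _ => ι) M i t))) z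
          ![bE (I 0), bE (I 1)]) = fun I₂ => iteratedFDeriv ℝ (n + 2 + 1) u z
          (fun t => bE (Fin.snoc (α := fun _ => ι) (Fin.cons (I₂ 0) (Fin.cons (I₂ 1) M)) i t))
        from funext fun I₂ => (hW I₂).symm]
    exact hvan
  -- symmetry of `D²v(z)`
  have hv : ContDiffAt ℝ ∞
      (fun x => iteratedFDeriv ℝ (n + 1) u x (fun t => bE (Fin.snoc (α := fun _ => ι) M i t))) z :=
    (contDiffOn_iteratedFDeriv_apply_const hO hu _).contDiffAt (hO.mem_nhds hzO)
  have hq : ∀ a b,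
      iteratedFDeriv ℝ 2
          (fun x => iteratedFDeriv ℝ (n + 1) u x (fun t => bE (Fin.snoc (α := fun _ => ι) M i t))) z
          ![bE a, bE b] =
        iteratedFDeriv ℝ 2
          (fun x => iteratedFDeriv ℝ (n + 1) u x (fun t => bE (Fin.snoc (α := fun _ => ι) M i t))) z
          ![bE b, bE a] := fun a b => by
    rw [iteratedFDeriv_two_apply, iteratedFDeriv_two_apply]
    simp only [Matrix.cons_val_zero, Matrix.cons_val_one]
    exact (hv.isSymmSndFDerivAt (by
      simp only [minSmoothness_of_isRCLikeNormedField]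
      exact WithTop.coe_le_coe.2 le_top)).eq _ _
  rw [sum_symCoef_mul G _ hq, topSym_apply, rhsFun]
  exact eq_neg_of_add_eq_zero_left key

omit [DecidableEq ι] in
/-- **The components of `D^{n+3}u` are second derivatives of the unknowns**:
`D^{n+3}u(z)(e_{I 0}, …, e_{I (n+2)})`
`= D²[D^{n+1}u(·)(e_{I 2}, …, e_{I (n+2)})](z)(e_{I 0}, e_{I 1})`
for `u` of class `C^{n+3}` at `z`. [folklore] -/
theorem iteratedFDeriv_basis_eq_two (bE : OrthonormalBasis ι ℝ E) {n : ℕ} {u : E → ℝ} {z : E}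
    (hu : ContDiffAt ℝ (n + 3 : ℕ) u z) (I : Fin (n + 3) → ι) :
    iteratedFDeriv ℝ (n + 3) u z (fun t => bE (I t)) =
      iteratedFDeriv ℝ 2 (fun x => iteratedFDeriv ℝ (n + 1) u x (fun t => bE (I t.succ.succ))) z
        ![bE (I 0), bE (I (Fin.succ 0))] := by
  rw [iteratedFDeriv_two_iteratedFDeriv_apply_const (n := n + 1) hu]
  have hI : (fun t => bE (I t)) = (Fin.cons (bE (I 0)) (Fin.cons (bE (I (Fin.succ 0)))
      (fun t => bE (I t.succ.succ))) : Fin (n + 3) → E) := by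
    funext t
    refine Fin.cases rfl (fun s => Fin.cases rfl (fun r => rfl) s) t
  rw [hI]


end Equation

end Literature.Analysis.PDE
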